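import Mathlib
import HarnessLib

/-!
# Sub-goal `stub_local1951_galois_linalg` of stub `stub_local1951_galois` (C1) of the crux
# `CorrespondentFingerprint` (stmt-Langlands-15898, line `Sketch`)

The LINEAR ALGEBRA of the Galois side at `1951`: a representation `σ` of a group `W` on `C²`
(`C` a field of characteristic zero) whose restriction to a normal subgroup `I ⊴ W` has exponent
dividing `m ≥ 1`, a non-zero fixed vector, and is non-trivial, is a direct sum of two characters
`χ₁ ⊕ χ₂` of `W` on some basis, with `χ₁|_I = 1`, `χ₂|_I ≠ 1` and `χ₂|_I` of exponent `m`.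

Proof (elementary, no Maschke).  On a basis `(e₁, x)` with `e₁` fixed by `I`, every `σ(u)`, `u ∈ I`,
is upper triangular `(1, β(u); 0, η(u))`.  If all `η(u) = 1` then `σ(u)` is unipotent of finite
order, hence `1` (characteristic zero) — so some `η(u₀) = ζ ≠ 1`, and `e₂ = x + β(u₀)(ζ-1)⁻¹ e₁` is
a `ζ`-eigenvector of `σ(u₀)`.  On `(e₁, e₂)`: the lower-right entries are multiplicative on `I`, so
commutators in `I` are unipotent of finite order, hence trivial; thus `σ(u)` commutes with
`σ(u₀) = diag(1, ζ)` and is diagonal for every `u ∈ I`.  For `w ∈ W`, `σ(u₀) σ(w) = σ(w) σ(w⁻¹u₀w)`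
with `σ(w⁻¹u₀w)` diagonal forces `σ(w)` diagonal (`ζ ≠ 1`).  [cite: SerreLocalFields1979, Ch. VI §2]
-/

set_option linter.dupNamespace false -- project-wide option (lakefile weak.linter.dupNamespace); `Summit.Langlands.Langlands` is the mandated namespace

noncomputable section

open scoped Matrix

namespace Summit.Langlands.Langlands.Theorems.CorrespondentFingerprint

variable {C : Type*} [Field C]

/-- Powers of a `2 × 2` unipotent upper triangular matrix: `(1, t; 0, 1)^k = (1, k t; 0, 1)`. [folklore] -/
theorem unipotent_fin_two_pow (t : C) (k : ℕ) :
    (!![1, t; 0, 1] : Matrix (Fin 2) (Fin 2) C) ^ k = !![1, k * t; 0, 1] := by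
  induction k with
  | zero => simp [Matrix.one_fin_two]
  | succ k ih =>
    rw [pow_succ, ih, Matrix.mul_fin_two]
    congr 1
    simp only [Nat.cast_succ, mul_one, one_mul, mul_zero, add_zero]
    ring

/-- A `2 × 2` unipotent upper triangular matrix of finite order over a field of characteristic zero
is the identity. [folklore] -/
theorem eq_one_of_unipotent_fin_two_pow_eq_one [CharZero C] {M : Matrix (Fin 2) (Fin 2) C}
    (h00 : M 0 0 = 1) (h10 : M 1 0 = 0) (h11 : M 1 1 = 1) {k : ℕ} (hk : 0 < k) (h : M ^ k = 1) :
    M = 1 := by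
  have hM : M = !![1, M 0 1; 0, 1] := by
    ext i j; fin_cases i <;> fin_cases j <;> simp [h00, h10, h11]
  rw [hM, unipotent_fin_two_pow] at h
  have h01 : (k : C) * M 0 1 = 0 := by
    have := congrFun (congrFun h 0) 1
    simpa using this
  have hk0 : (k : C) ≠ 0 := by exact_mod_cast hk.ne'
  have ht : M 0 1 = 0 := (mul_eq_zero.mp h01).resolve_left hk0
  rw [hM, ht, Matrix.one_fin_two]

/-- **Sub-goal `stub_local1951_galois_linalg`** (registered): the linear algebra of the Galois side
at `1951` for the stub `stub_local1951_galois` (C1).  A representation `σ` of a group `W` on `C²`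
(`char C = 0`) such that, on a normal subgroup `I`, `σ(u)^m = 1` (`m ≥ 1`), some non-zero vector is
fixed and some `σ(u) ≠ 1`, is `χ₁ ⊕ χ₂` on a basis `b` for characters `χ₁, χ₂ : W → Cˣ` with
`χ₁|_I = 1`, `χ₂|_I ≠ 1`, `(χ₂|_I)^m = 1`. [cite: SerreLocalFields1979, Ch. VI §2] -/
theorem stub_local1951_galois_linalg : ∀ (C : Type*) [Field C] [CharZero C] (W : Type*) [Group W]
    (I : Subgroup W) [I.Normal] (σ : Representation C W (Fin 2 → C)) (m : ℕ), 0 < m →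
    (∀ u ∈ I, σ u ^ m = 1) → (∃ e : Fin 2 → C, e ≠ 0 ∧ ∀ u ∈ I, σ u e = e) →
    (∃ u ∈ I, σ u ≠ 1) →
    ∃ (χ₁ χ₂ : W →* Cˣ) (b : Module.Basis (Fin 2) C (Fin 2 → C)),
      (∀ w, σ w (b 0) = ((χ₁ w : Cˣ) : C) • b 0) ∧ (∀ w, σ w (b 1) = ((χ₂ w : Cˣ) : C) • b 1) ∧
      (∀ u ∈ I, χ₁ u = 1) ∧ (∃ u ∈ I, χ₂ u ≠ 1) ∧ ∀ u ∈ I, χ₂ u ^ m = 1 := by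
  intro C _ _ W _ I hN σ m hm hIm hfix hnt
  classical
  obtain ⟨e₁, he₁, hfix⟩ := hfix
  obtain ⟨u₁, hu₁I, hu₁⟩ := hnt
  have hcard : Fintype.card (Fin 2) = Module.finrank C (Fin 2 → C) := by
    rw [Fintype.card_fin, Module.finrank_fin_fun]
  -- matrices on a basis `b` with `b 0 = e₁`: generalities
  have key : ∀ (b : Module.Basis (Fin 2) C (Fin 2 → C)), b 0 = e₁ →
      (∀ w w', LinearMap.toMatrix b b (σ (w * w')) =
        LinearMap.toMatrix b b (σ w) * LinearMap.toMatrix b b (σ w')) ∧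
      (∀ u ∈ I, LinearMap.toMatrix b b (σ u) 0 0 = 1 ∧ LinearMap.toMatrix b b (σ u) 1 0 = 0) ∧
      (∀ w, σ w (b 1) = LinearMap.toMatrix b b (σ w) 0 1 • b 0 +
        LinearMap.toMatrix b b (σ w) 1 1 • b 1) ∧
      (∀ w, σ w (b 0) = LinearMap.toMatrix b b (σ w) 0 0 • b 0 +
        LinearMap.toMatrix b b (σ w) 1 0 • b 1) := by
    intro b hb0
    refine ⟨fun w w' => by rw [map_mul, LinearMap.toMatrix_mul], fun u hu => ?_, fun w => ?_,
      fun w => ?_⟩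
    · simp only [LinearMap.toMatrix_apply, hb0, hfix u hu]
      rw [← hb0, b.repr_self]
      simp
    · have h := Matrix.toLin_self b b (LinearMap.toMatrix b b (σ w)) 1
      rw [Matrix.toLin_toMatrix, Fin.sum_univ_two] at h
      exact h
    · have h := Matrix.toLin_self b b (LinearMap.toMatrix b b (σ w)) 0
      rw [Matrix.toLin_toMatrix, Fin.sum_univ_two] at h
      exact h
  -- a first basis `b₀ = (e₁, x)` and an element `u₀ ∈ I` with lower-right entry `ζ ≠ 1`
  obtain ⟨x, hli⟩ := exists_linearIndependent_pair_of_one_lt_finrank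
    (by rw [Module.finrank_fin_fun]; norm_num) he₁
  set b₀ : Module.Basis (Fin 2) C (Fin 2 → C) := basisOfLinearIndependentOfCardEqFinrank hli hcard
    with hb₀_def
  have hb₀0 : b₀ 0 = e₁ := by simp [hb₀_def]
  have hb₀1 : b₀ 1 = x := by simp [hb₀_def]
  obtain ⟨hmul₀, hcol₀, hcolone₀, -⟩ := key b₀ hb₀0
  obtain ⟨u₀, hu₀I, hζ⟩ : ∃ u₀ ∈ I, LinearMap.toMatrix b₀ b₀ (σ u₀) 1 1 ≠ 1 := by
    by_contra hall
    push Not at hall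
    apply hu₁
    have hM := eq_one_of_unipotent_fin_two_pow_eq_one (hcol₀ u₁ hu₁I).1 (hcol₀ u₁ hu₁I).2
      (hall u₁ hu₁I) hm (by rw [LinearMap.toMatrix_pow, hIm u₁ hu₁I, LinearMap.toMatrix_one])
    exact (LinearMap.toMatrix b₀ b₀).injective (hM.trans (LinearMap.toMatrix_one b₀).symm)
  set ζ : C := LinearMap.toMatrix b₀ b₀ (σ u₀) 1 1 with hζ_def
  set β : C := LinearMap.toMatrix b₀ b₀ (σ u₀) 0 1 with hβ_def
  have hζ1 : ζ - 1 ≠ 0 := sub_ne_zero.mpr hζ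
  -- the `ζ`-eigenvector `e₂` of `σ u₀` and the basis `b = (e₁, e₂)`
  set e₂ : Fin 2 → C := x + ((ζ - 1)⁻¹ * β) • e₁ with he₂_def
  have he₂ : σ u₀ e₂ = ζ • e₂ := by
    have hx : σ u₀ x = β • e₁ + ζ • x := by rw [← hb₀1, hcolone₀ u₀, hb₀0]
    rw [he₂_def, map_add, map_smul, hx, hfix u₀ hu₀I]
    have hc : β + (ζ - 1)⁻¹ * β = ζ * ((ζ - 1)⁻¹ * β) := by field_simp; ring
    calc β • e₁ + ζ • x + ((ζ - 1)⁻¹ * β) • e₁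
        = ζ • x + (β + (ζ - 1)⁻¹ * β) • e₁ := by rw [add_smul]; abel
      _ = ζ • x + (ζ * ((ζ - 1)⁻¹ * β)) • e₁ := by rw [hc]
      _ = ζ • (x + ((ζ - 1)⁻¹ * β) • e₁) := by rw [smul_add, smul_smul]
  have hli' : LinearIndependent C ![e₁, e₂] := by
    rw [LinearIndependent.pair_iff] at hli ⊢
    intro s t hst
    have h1 : (s + t * ((ζ - 1)⁻¹ * β)) • e₁ + t • x = 0 := by
      rw [← hst, he₂_def, smul_add, smul_smul, add_smul]; abel
    obtain ⟨h2, h3⟩ := hli _ _ h1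
    refine ⟨?_, h3⟩
    rw [h3, zero_mul, add_zero] at h2
    exact h2
  set b : Module.Basis (Fin 2) C (Fin 2 → C) := basisOfLinearIndependentOfCardEqFinrank hli' hcard
    with hb_def
  have hb0 : b 0 = e₁ := by simp [hb_def]
  have hb1 : b 1 = e₂ := by simp [hb_def]
  obtain ⟨hmul', hcol', hcolone', hcolzero'⟩ := key b hb0
  -- `M w`, the matrix of `σ w` on `b`
  obtain ⟨M, hM⟩ : ∃ M : W → Matrix (Fin 2) (Fin 2) C, ∀ w, M w = LinearMap.toMatrix b b (σ w) :=
    ⟨_, fun w => rfl⟩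
  have hmul : ∀ w w', M (w * w') = M w * M w' := fun w w' => by rw [hM, hM, hM]; exact hmul' w w'
  have hcol : ∀ u ∈ I, M u 0 0 = 1 ∧ M u 1 0 = 0 := fun u hu => by rw [hM]; exact hcol' u hu
  have hcolone : ∀ w, σ w (b 1) = M w 0 1 • b 0 + M w 1 1 • b 1 := fun w => by
    rw [hM]; exact hcolone' w
  have hcolzero : ∀ w, σ w (b 0) = M w 0 0 • b 0 + M w 1 0 • b 1 := fun w => by
    rw [hM]; exact hcolzero' w
  have hM1 : M 1 = 1 := by rw [hM, map_one, LinearMap.toMatrix_one]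
  have hMpow : ∀ u ∈ I, M u ^ m = 1 := fun u hu => by
    rw [hM, LinearMap.toMatrix_pow, hIm u hu, LinearMap.toMatrix_one]
  -- `M u₀ = diag(1, ζ)`
  have hu₀01 : M u₀ 0 1 = 0 ∧ M u₀ 1 1 = ζ := by
    have h1 : b.repr (σ u₀ (b 1)) = Finsupp.single 1 ζ := by
      rw [hb1, he₂, map_smul, ← hb1, b.repr_self, Finsupp.smul_single, smul_eq_mul, mul_one]
    constructor
    · rw [hM, LinearMap.toMatrix_apply, h1]; simp
    · rw [hM, LinearMap.toMatrix_apply, h1]; simp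
  -- lower-right entries are multiplicative on `I`; commutators are trivial; `M u` is diagonal
  have hδmul : ∀ u ∈ I, ∀ v ∈ I, M (u * v) 1 1 = M u 1 1 * M v 1 1 := by
    intro u hu v hv
    rw [hmul u v, Matrix.mul_apply, Fin.sum_univ_two, (hcol u hu).2, zero_mul, zero_add]
  have hδinv : ∀ u ∈ I, M u⁻¹ 1 1 * M u 1 1 = 1 := by
    intro u hu
    rw [← hδmul u⁻¹ (inv_mem hu) u hu, inv_mul_cancel, hM1, Matrix.one_apply_eq]
  have hcomm : ∀ u ∈ I, M u * M u₀ = M u₀ * M u := by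
    intro u hu
    have hcI : u * u₀ * u⁻¹ * u₀⁻¹ ∈ I :=
      mul_mem (mul_mem (mul_mem hu hu₀I) (inv_mem hu)) (inv_mem hu₀I)
    have hc11 : M (u * u₀ * u⁻¹ * u₀⁻¹) 1 1 = 1 := by
      rw [hδmul _ (mul_mem (mul_mem hu hu₀I) (inv_mem hu)) _ (inv_mem hu₀I),
        hδmul _ (mul_mem hu hu₀I) _ (inv_mem hu), hδmul _ hu _ hu₀I]
      calc M u 1 1 * M u₀ 1 1 * M u⁻¹ 1 1 * M u₀⁻¹ 1 1
          = (M u⁻¹ 1 1 * M u 1 1) * (M u₀⁻¹ 1 1 * M u₀ 1 1) := by ring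
        _ = 1 := by rw [hδinv u hu, hδinv u₀ hu₀I, one_mul]
    have hc : M (u * u₀ * u⁻¹ * u₀⁻¹) = 1 :=
      eq_one_of_unipotent_fin_two_pow_eq_one (hcol _ hcI).1 (hcol _ hcI).2 hc11 hm (hMpow _ hcI)
    have h : M (u * u₀) = M (u * u₀ * u⁻¹ * u₀⁻¹) * M (u₀ * u) := by
      rw [← hmul]; congr 1; group
    rwa [hmul, hc, one_mul, hmul] at h
  have hdiag : ∀ u ∈ I, M u 0 1 = 0 := by
    intro u hu
    have h := congrFun (congrFun (hcomm u hu) 0) 1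
    simp only [Matrix.mul_apply, Fin.sum_univ_two, (hcol u hu).1, hu₀01.1, hu₀01.2,
      (hcol u₀ hu₀I).1] at h
    have : M u 0 1 * (ζ - 1) = 0 := by linear_combination h
    exact (mul_eq_zero.mp this).resolve_right hζ1
  -- every `M w` is diagonal with non-zero diagonal entries
  have hW : ∀ w, M w 1 0 = 0 ∧ M w 0 1 = 0 ∧ M w 0 0 ≠ 0 ∧ M w 1 1 ≠ 0 := by
    intro w
    have hu'I : w⁻¹ * u₀ * w ∈ I := by simpa using hN.conj_mem u₀ hu₀I w⁻¹
    have hrel : M u₀ * M w = M w * M (w⁻¹ * u₀ * w) := by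
      rw [← hmul, ← hmul]; congr 1; group
    have h10 := congrFun (congrFun hrel 1) 0
    have h01 := congrFun (congrFun hrel 0) 1
    have h11 := congrFun (congrFun hrel 1) 1
    simp only [Matrix.mul_apply, Fin.sum_univ_two, hu₀01.1, hu₀01.2, (hcol u₀ hu₀I).1,
      (hcol u₀ hu₀I).2, (hcol _ hu'I).1, (hcol _ hu'I).2, hdiag _ hu'I] at h10 h01 h11
    have hc0 : M w 1 0 = 0 := by
      have : (ζ - 1) * M w 1 0 = 0 := by linear_combination h10
      exact (mul_eq_zero.mp this).resolve_left hζ1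
    have hdet : (M w).det ≠ 0 := by
      have h := congrArg Matrix.det (hmul w w⁻¹)
      rw [mul_inv_cancel, hM1, Matrix.det_one, Matrix.det_mul] at h
      intro h0
      rw [h0, zero_mul] at h
      exact one_ne_zero h
    rw [Matrix.det_fin_two, hc0, mul_zero, sub_zero] at hdet
    have ha : M w 0 0 ≠ 0 := left_ne_zero_of_mul hdet
    have hd : M w 1 1 ≠ 0 := right_ne_zero_of_mul hdet
    have hδ' : M (w⁻¹ * u₀ * w) 1 1 = ζ := by
      have : M w 1 1 * (M (w⁻¹ * u₀ * w) 1 1 - ζ) = 0 := by linear_combination -h11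
      exact sub_eq_zero.mp ((mul_eq_zero.mp this).resolve_left hd)
    have hb' : M w 0 1 = 0 := by
      rw [hδ'] at h01
      have : M w 0 1 * (ζ - 1) = 0 := by linear_combination -h01
      exact (mul_eq_zero.mp this).resolve_right hζ1
    exact ⟨hc0, hb', ha, hd⟩
  -- the characters `χ₁ = M · 0 0`, `χ₂ = M · 1 1`
  refine ⟨MonoidHom.mk' (fun w => Units.mk0 (M w 0 0) (hW w).2.2.1) ?_,
    MonoidHom.mk' (fun w => Units.mk0 (M w 1 1) (hW w).2.2.2) ?_, b, ?_, ?_, ?_, ?_, ?_⟩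
  · intro w w'
    ext
    simp only [Units.val_mk0, Units.val_mul]
    rw [hmul, Matrix.mul_apply, Fin.sum_univ_two, (hW w).2.1, zero_mul, add_zero]
  · intro w w'
    ext
    simp only [Units.val_mk0, Units.val_mul]
    rw [hmul, Matrix.mul_apply, Fin.sum_univ_two, (hW w).1, zero_mul, zero_add]
  · intro w
    simp only [MonoidHom.mk'_apply, Units.val_mk0]
    rw [hcolzero w, (hW w).1, zero_smul, add_zero]
  · intro w
    simp only [MonoidHom.mk'_apply, Units.val_mk0]
    rw [hcolone w, (hW w).2.1, zero_smul, zero_add]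
  · intro u hu
    ext
    simp only [MonoidHom.mk'_apply, Units.val_mk0, Units.val_one]
    exact (hcol u hu).1
  · refine ⟨u₀, hu₀I, fun h => hζ ?_⟩
    have h' := congrArg (fun x : Cˣ => (x : C)) h
    simp only [MonoidHom.mk'_apply, Units.val_mk0, Units.val_one, hu₀01.2] at h'
    exact h'
  · intro u hu
    rw [← map_pow]
    ext
    simp only [MonoidHom.mk'_apply, Units.val_mk0, Units.val_one]
    have h1 : M (u ^ m) = 1 := by
      rw [hM, map_pow, ← LinearMap.toMatrix_pow, ← hM, hMpow u hu]
    rw [h1, Matrix.one_apply_eq]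

end Summit.Langlands.Langlands.Theorems.CorrespondentFingerprint

end
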